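import Summits.QuantumFields.BalabanUV.Beta.GAN24.DirichletVertexPullback
import Summits.QuantumFields.BalabanUV.Beta.GAN24.DirichletRingSiteWeighted
import Summits.QuantumFields.BalabanUV.Beta.GAN24.DirichletBoxCompression

/-!
# `BalabanUV.Beta.GAN24.DirichletVertexEnergy` — binder row G-an2-4 / (CONV-C), road P2 PART IV, leaf L14 (the torus transfer), FILE B1:
# BINDER (B) ON THE TORUS — the inverse-distance-weighted energy of the Dirichlet solution on a union of unit blocks in `d = 2`
# (unit b2b-balaban-gan24-p2, gen 26, v1)

HONEST FRAMING (cell contract, verbatim): «discharging `BetaPertH` makes Bałaban's UV stability UNCONDITIONAL — a real constructive-QFT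
result; it is NOT the continuum limit and NOT the Clay problem.»  SUPPLIER module under the T⁴-DAG sub-row `T4-U1a.S-NE2-D1-DIRICHLET°`
(holder: the t4-ne2-p1 lineage; owner wording R24 «the full rate L⁻¹ beyond boxes OPEN»).  The weighted socket
`DirichletBoxWeightedSockets.injected_le_of_weighted` (p234489) displays four one-level binders; binder (B) is the inverse-weighted energy
`Σ_μ Σ_y ω(y)⁻¹ |(∂_μ u_f)(y)|² ≤ β‖f‖²` of the zero-extended Dirichlet solution `u_f = solExt f` for a coarse weight `ω > 0`.  THIS FILE
proves (B) on the torus `Tor (fine n M)`, `d = 2`, for `Ω = blockReg n M S` ANY set of unit blocks `S`, with the weight `ω_V` built from ANY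
finite family `V` of re-entrant vertices `(σ, b)` of `S` (memo `gen24/W-FULL-WEIGHTED.md` §3 L9 + memo `gen25/RING-LEMMA-KERNEL.md` §7):
`ω_V(y)⁻¹ = 1 + Σ_{v ∈ V} invW_v(y)`, `invW_v` = the push-forward along the chart `emb σ b` of the model site weight `n/ρ` on the window
`Q_{n−1}` (`ρ = max(tIdx i, tIdx j)` the ring index; `n/ρ ≍ dist(y, vertex)⁻¹` in block units).  The constant `β` depends on `|V|`, `ε`
and `a′` only — NOT on `n`, `M`, `S`.

## Contents ([folklore] finite sums on the tree's typed objects + the model ENDs BY NAME; 0 sorry)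

* §1 `invW`, `omegaV`: nonnegativity, `0 < ω_V ≤ 1`, `ω_V⁻¹ = 1 + Σ invW`; the EXCHANGE `Σ_y invW_v(y)·F(y) = Σ_{Q_K} (n/ρ)·F∘emb`.
* §2 **`vertex_weighted_energy_le`**: for `u` vanishing off `Ω` at a re-entrant `(σ, b)`, `2 ≤ n`, `2 ≤ M_ν`, `0 < ε`, `1 < γ = π/3·(1−ε/2)`:
  `Σ_μ Σ_y invW_{(σ,b)}(y)·|(∂_μ u)(y)|² ≤ 4(1 + 16/(γ−1))·(‖∂₀u‖² + ‖∂₁u‖²) + (128π/((γ−1)ε(2−γ)))·Σ_{x∈Ω}|(Δu)(x)|²`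
  — the dictionary (`DirichletVertexChart`), `nbr (Up u) = nbr (Uc u)` on `Q_{n−1}`, the model END `DirichletRingSiteWeighted.site_weighted_energy_le`
  at model parameter `K = n − 1` with `hU := Uc_quadrant`, `hEq := lap_Uc_eq_Gc`, and the sum comparisons `Et_Uc_le`, `sqSum_Gc_le`.
* §3 **BINDER (B) ON THE TORUS `weighted_energy_solExt_le`**: for `u = solExt n M a′ Ω f`,
  `Σ_μ Σ_y ω_V(y)⁻¹ |(∂_μ u)(y)|² ≤ β_V·‖f‖²`, `β_V = γ′⁻¹(1 + 4|V|(1 + 16/(γ−1))) + |V|·(256π/((γ−1)ε(2−γ)))·(1 + (a′γ′⁻¹)²)`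
  (M-C `dirichlet_solExt_le`, `sum_normSq_LapS_solExt_le` BY NAME).

ABSOLUTE RULE (cell, verbatim): «No internally-minted statement may enter as a cited fact. Every hypothesis is either kernel-proved in
this package or a verbatim quotation of a PUBLISHED theorem with page reference. The manuscript(s) under audit are NOT citable for
their own disputed steps — they are the thing under adjudication; programme-internal (2001/route/tribunal) claims are never citable.»
Nothing printed is a hypothesis.  NOT CLAIMED: binder (A)/(A′) on the torus, the comparison `ω ≤ w′` on windows, (Φ)/(Φ′), hence NOT the
unconditional weighted END; NOT the vector layer, NE2, (CONV-C) as a whole, `BetaPertH`, continuum, Clay.  «not in print; our proof attempt».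
HONEST DEPENDENCY: continuum YM on T⁴ ⇐ BetaPertH ∧ nine spine estimates (0/9 proved); BetaPertH ⇐ (D1) ∧ (D4) ∧ CAP+tail; G-an2-4 gates
asym, D1 and NE2/3/4.
-/

noncomputable section

open scoped BigOperators ComplexConjugate Matrix
open Finset

namespace Summit.QuantumFields.BalabanUV.Beta.GAN24.DirichletVertexEnergy

open Literature.MathematicalPhysics.QuantumFieldTheory.Balaban1983to89.B5Prop11Plancherel (Tor fine unitVec)
open Literature.MathematicalPhysics.QuantumFieldTheory.Balaban1983to89.B5Action121 (sdiff LapS)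
open Literature.MathematicalPhysics.QuantumFieldTheory.Balaban1983to89.B5Prop11Lower (nsq nsq_nonneg)
open Summit.QuantumFields.BalabanUV.T4Continuum.ScalarAveragedPropagator (gammaPs gammaPs_pos dirichlet)
open Summit.QuantumFields.BalabanUV.Beta.GAN24.DirichletBoxTrace (blockReg)
open Summit.QuantumFields.BalabanUV.Beta.GAN24.DirichletBoxCompression (solExt solExt_apply_of_not dirichlet_solExt_le sum_normSq_LapS_solExt_le)
open DirichletRingEnergies (hb vb lap Et sqSum Et_nonneg sqSum_nonneg)
open DirichletRingCutoff (tIdx one_le_tIdx)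
open DirichletRingHessianWindow (rho nbr)
open DirichletRingSiteWeighted (site_weighted_energy_le)
open DirichletVertexChart
open DirichletVertexPullback

variable (n : ℕ) [NeZero n] (M : Fin 2 → ℕ) [hM : ∀ μ, NeZero (M μ)]

/-! ## §1 The push-forward weights -/

/-- the ring index is at least `1`. [folklore] -/
theorem one_le_rho (i j : ℤ) : (1 : ℤ) ≤ rho i j := (one_le_tIdx i).trans (le_max_left _ _)

/-- the PUSHED-FORWARD INVERSE WEIGHT of the vertex `v = (σ, b)` with model parameter `K`:
`invW v K y = Σ_{(s,t) ∈ [0,2K)²} [y = emb σ b (−K+s, −K+t)]·n/ρ(−K+s, −K+t)`. [folklore] -/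
def invW (v : (Fin 2 → Bool) × Tor M) (K : ℕ) (y : Tor (fine n M)) : ℝ :=
  ∑ t ∈ range (2 * K), ∑ s ∈ range (2 * K),
    if y = emb n M v.1 v.2 (-(K : ℤ) + s) (-(K : ℤ) + t) then (n : ℝ) / (rho (-(K : ℤ) + s) (-(K : ℤ) + t) : ℝ) else 0

omit [NeZero n] hM in
/-- `0 ≤ invW`. [folklore] -/
theorem invW_nonneg (v : (Fin 2 → Bool) × Tor M) (K : ℕ) (y : Tor (fine n M)) : 0 ≤ invW n M v K y := by
  refine sum_nonneg fun t _ => sum_nonneg fun s _ => ?_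
  split_ifs
  · have h1 : (0 : ℝ) < (rho (-(K : ℤ) + s) (-(K : ℤ) + t) : ℝ) := by exact_mod_cast (one_le_rho _ _)
    positivity
  · exact le_rfl

/-- **EXCHANGE OF SUMS**: `Σ_y invW_v(y)·F(y) = Σ_{(s,t)} (n/ρ(−K+s,−K+t))·F(emb σ b (−K+s) (−K+t))`. [folklore] -/
theorem sum_invW_mul (v : (Fin 2 → Bool) × Tor M) (K : ℕ) (F : Tor (fine n M) → ℝ) :
    ∑ y, invW n M v K y * F y
      = ∑ t ∈ range (2 * K), ∑ s ∈ range (2 * K),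
          (n : ℝ) / (rho (-(K : ℤ) + s) (-(K : ℤ) + t) : ℝ) * F (emb n M v.1 v.2 (-(K : ℤ) + s) (-(K : ℤ) + t)) := by
  simp only [invW, sum_mul]
  rw [sum_comm]
  refine sum_congr rfl fun t _ => ?_
  rw [sum_comm]
  refine sum_congr rfl fun s _ => ?_
  simp only [ite_mul, zero_mul, sum_ite_eq', mem_univ, if_true]

/-- the COARSE WEIGHT of a finite family `V` of vertices: `ω_V(y) = (1 + Σ_{v ∈ V} invW_v(y))⁻¹`. [folklore] -/
def omegaV (V : Finset ((Fin 2 → Bool) × Tor M)) (K : ℕ) (y : Tor (fine n M)) : ℝ := (1 + ∑ v ∈ V, invW n M v K y)⁻¹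

omit [NeZero n] hM in
/-- `ω_V⁻¹ = 1 + Σ_v invW_v`. [folklore] -/
theorem inv_omegaV (V : Finset ((Fin 2 → Bool) × Tor M)) (K : ℕ) (y : Tor (fine n M)) :
    (omegaV n M V K y)⁻¹ = 1 + ∑ v ∈ V, invW n M v K y := by
  rw [omegaV, inv_inv]

omit [NeZero n] hM in
/-- `0 < ω_V`. [folklore] -/
theorem omegaV_pos (V : Finset ((Fin 2 → Bool) × Tor M)) (K : ℕ) (y : Tor (fine n M)) : 0 < omegaV n M V K y := by
  have := sum_nonneg fun v (_ : v ∈ V) => invW_nonneg n M v K y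
  unfold omegaV; positivity

omit [NeZero n] hM in
/-- `ω_V ≤ 1`. [folklore] -/
theorem omegaV_le_one (V : Finset ((Fin 2 → Bool) × Tor M)) (K : ℕ) (y : Tor (fine n M)) : omegaV n M V K y ≤ 1 := by
  have := sum_nonneg fun v (_ : v ∈ V) => invW_nonneg n M v K y
  unfold omegaV
  exact inv_le_one_of_one_le₀ (by linarith)

/-! ## §2 The weighted energy charged to one re-entrant vertex -/

section Vertex

variable {S : Tor M → Prop} {σ : Fin 2 → Bool} {b : Tor M} {u : Tor (fine n M) → ℂ}

omit [NeZero n] hM in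
/-- the four incident bonds at a model site are `nbr`: `hb U i j + hb U (i−1) j + vb U i j + vb U i (j−1) = nbr U i j`. [folklore] -/
theorem bonds_eq_nbr (U : ℤ → ℤ → ℂ) (i j : ℤ) : hb U i j + hb U (i - 1) j + vb U i j + vb U i (j - 1) = nbr U i j := by
  simp only [hb, vb, nbr, sub_add_cancel]
  rw [norm_sub_rev (U i j) (U (i - 1) j), norm_sub_rev (U i j) (U i (j - 1))]

/-- on the window `Q_n = [−n, n)²` the two pull-backs of a field vanishing off `Ω` agree. [folklore] -/
theorem Uc_eq_Up_of_window (hu : ∀ x, ¬ blockReg n M S x → u x = 0) (hre : ReentrantAt M S σ b) {i j : ℤ}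
    (hi' : i < n) (hj' : j < n) : Uc n M σ b u i j = Up n M σ b u i j := by
  by_cases hq : 0 ≤ i ∧ 0 ≤ j
  · rw [Uc, if_pos hq, Up_eq_zero_of_quadrant n M hu hre hq.1 hi' hq.2 hj']
  · exact Uc_of_not n M σ b u hq

/-- hence `nbr (Up u) = nbr (Uc u)` on `Q_{n−1}`. [folklore] -/
theorem nbr_Up_eq (hu : ∀ x, ¬ blockReg n M S x → u x = 0) (hre : ReentrantAt M S σ b) {i j : ℤ}
    (hi' : i < n - 1) (hj' : j < n - 1) :
    nbr (Up n M σ b u) i j = nbr (Uc n M σ b u) i j := by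
  simp only [nbr]
  rw [Uc_eq_Up_of_window n M hu hre (i := i) (j := j) (by omega) (by omega),
    Uc_eq_Up_of_window n M hu hre (i := i + 1) (j := j) (by omega) (by omega),
    Uc_eq_Up_of_window n M hu hre (i := i - 1) (j := j) (by omega) (by omega),
    Uc_eq_Up_of_window n M hu hre (i := i) (j := j + 1) (by omega) (by omega),
    Uc_eq_Up_of_window n M hu hre (i := i) (j := j - 1) (by omega) (by omega)]

/-- **THE WEIGHTED ENERGY CHARGED TO ONE RE-ENTRANT VERTEX**: for `u` vanishing off `Ω` at a re-entrant `(σ, b)`, `2 ≤ n`, `2 ≤ M_ν`,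
`0 < ε`, `1 < γ = π/3·(1−ε/2)`:
`Σ_μ Σ_y invW_{(σ,b)}(y)·|(∂_μ u)(y)|² ≤ 4(1 + 16/(γ−1))·(‖∂₀u‖² + ‖∂₁u‖²) + (128π/((γ−1)ε(2−γ)))·Σ_{x∈Ω}|(Δu)(x)|²`. [folklore] -/
theorem vertex_weighted_energy_le [DecidablePred S] (hu : ∀ x, ¬ blockReg n M S x → u x = 0) (hre : ReentrantAt M S σ b)
    (hn : 2 ≤ n) (hM0 : 2 ≤ M 0) (hM1 : 2 ≤ M 1) {ε : ℝ} (hε : 0 < ε) (hγ : 1 < Real.pi / 3 * (1 - ε / 2)) :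
    ∑ μ, ∑ y, invW n M (σ, b) (n - 1) y * ‖(sdiff (fine n M) (n : ℂ) μ *ᵥ u) y‖ ^ 2
      ≤ 4 * (1 + 16 / (Real.pi / 3 * (1 - ε / 2) - 1))
          * (nsq (sdiff (fine n M) (n : ℂ) 0 *ᵥ u) + nsq (sdiff (fine n M) (n : ℂ) 1 *ᵥ u))
        + 128 * Real.pi / ((Real.pi / 3 * (1 - ε / 2) - 1) * ε * (2 - Real.pi / 3 * (1 - ε / 2)))
          * ∑ x ∈ univ.filter (blockReg n M S), ‖(LapS (fine n M) (n : ℂ) *ᵥ u) x‖ ^ 2 := by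
  -- abbreviations
  set K : ℕ := n - 1 with hK
  have hK1 : 1 ≤ K := by omega
  have hKn : K ≤ n := by omega
  have hKn' : (K : ℤ) = (n : ℤ) - 1 := by omega
  set γ : ℝ := Real.pi / 3 * (1 - ε / 2) with hγdef
  set U : ℤ → ℤ → ℂ := Uc n M σ b u with hUdef
  set E : ℝ := nsq (sdiff (fine n M) (n : ℂ) 0 *ᵥ u) + nsq (sdiff (fine n M) (n : ℂ) 1 *ᵥ u) with hE
  set B : ℝ := ∑ x ∈ univ.filter (blockReg n M S), ‖(LapS (fine n M) (n : ℂ) *ᵥ u) x‖ ^ 2 with hB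
  have hπ3 := Real.pi_gt_three
  have hπ4 := Real.pi_lt_four
  have hε2 : ε < 2 := by
    by_contra h
    have : Real.pi / 3 * (1 - ε / 2) ≤ 0 := mul_nonpos_of_nonneg_of_nonpos (by positivity) (by linarith)
    linarith
  have hγ2 : γ < 2 := by
    have : Real.pi / 3 * (1 - ε / 2) < Real.pi / 3 * 1 := mul_lt_mul_of_pos_left (by linarith) (by positivity)
    rw [hγdef]; linarith
  have hγ1 : 0 < γ - 1 := by rw [hγdef]; linarith
  have h2γ : 0 < 2 - γ := by linarith
  have hnR : (2 : ℝ) ≤ n := by exact_mod_cast hn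
  have hn0 : (0 : ℝ) < n := by linarith
  have hKR : (K : ℝ) = n - 1 := by rw [hK]; push_cast [Nat.cast_sub (by omega : 1 ≤ n)]; ring
  have hK0 : (0 : ℝ) < K := by rw [hKR]; linarith
  have hE0 : 0 ≤ E := add_nonneg (nsq_nonneg _) (nsq_nonneg _)
  have hB0 : 0 ≤ B := sum_nonneg fun _ _ => sq_nonneg _
  have hW0 : 2 * K + 2 ≤ n * M 0 := by have := Nat.mul_le_mul_left n hM0; omega
  have hW1 : 2 * K + 2 ≤ n * M 1 := by have := Nat.mul_le_mul_left n hM1; omega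
  -- the model inputs at parameter `K`
  have hUq : ∀ s t : ℤ, 0 ≤ s → 0 ≤ t → U s t = 0 := Uc_quadrant n M σ b u
  have hEq : ∀ i j : ℤ, -(K : ℤ) ≤ i → i < K → -(K : ℤ) ≤ j → j < K → ¬(0 ≤ i ∧ 0 ≤ j) → lap U i j = Gc n M σ b u i j :=
    fun i j hi hi' hj hj' hq => lap_Uc_eq_Gc n M hu hre i j (by omega) (by omega) (by omega) (by omega) hq
  have hEt : Et U K ≤ E / (n : ℝ) ^ 2 := Et_Uc_le n M hu hre hKn hW0 hW1
  have hSG : sqSum (fun i j => ‖Gc n M σ b u i j‖ ^ 2) K ≤ B / (n : ℝ) ^ 4 :=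
    sqSum_Gc_le n M hre u hKn (by omega) (by omega)
  have hsite := site_weighted_energy_le U hK1 (Gc n M σ b u) hUq hEq hε hγ
  -- Step 1: exchange of sums and the dictionary: LHS ≤ n³·Σ_{Q_K} nbr U/ρ
  have step1 : ∑ μ, ∑ y, invW n M (σ, b) K y * ‖(sdiff (fine n M) (n : ℂ) μ *ᵥ u) y‖ ^ 2
      ≤ (n : ℝ) ^ 3 * sqSum (fun i j => nbr U i j / (rho i j : ℝ)) K := by
    rw [Fin.sum_univ_two, sum_invW_mul, sum_invW_mul, ← sum_add_distrib, sqSum, mul_sum]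
    refine sum_le_sum fun t ht => ?_
    rw [← sum_add_distrib, mul_sum]
    refine sum_le_sum fun s hs => ?_
    simp only [mem_range] at ht hs
    set i : ℤ := -(K : ℤ) + s with hi
    set j : ℤ := -(K : ℤ) + t with hj
    have hρ : (0 : ℝ) < (rho i j : ℝ) := by exact_mod_cast (one_le_rho i j)
    have h0 := normSq_sdiff_emb_fst_le n M σ b u i j
    have h1 := normSq_sdiff_emb_snd_le n M σ b u i j
    have hnbr : hb (Up n M σ b u) i j + hb (Up n M σ b u) (i - 1) j + (vb (Up n M σ b u) i j + vb (Up n M σ b u) i (j - 1))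
        = nbr U i j := by
      rw [← add_assoc, bonds_eq_nbr, hUdef, nbr_Up_eq n M hu hre (by omega) (by omega)]
    calc (n : ℝ) / (rho i j : ℝ) * ‖(sdiff (fine n M) (n : ℂ) 0 *ᵥ u) (emb n M σ b i j)‖ ^ 2
          + (n : ℝ) / (rho i j : ℝ) * ‖(sdiff (fine n M) (n : ℂ) 1 *ᵥ u) (emb n M σ b i j)‖ ^ 2
        ≤ (n : ℝ) / (rho i j : ℝ) * ((n : ℝ) ^ 2 * (hb (Up n M σ b u) i j + hb (Up n M σ b u) (i - 1) j))
          + (n : ℝ) / (rho i j : ℝ) * ((n : ℝ) ^ 2 * (vb (Up n M σ b u) i j + vb (Up n M σ b u) i (j - 1))) :=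
          add_le_add (mul_le_mul_of_nonneg_left h0 (by positivity)) (mul_le_mul_of_nonneg_left h1 (by positivity))
      _ = (n : ℝ) ^ 3 * (nbr U i j / (rho i j : ℝ)) := by
          rw [← hnbr]; ring
  -- Step 2: the model END and the sum comparisons
  have hM : Et U K + (Real.pi / (2 * ε) * sqSum (fun i j => ‖Gc n M σ b u i j‖ ^ 2) K) * ((K : ℝ) + 3) ^ 2 / (2 - γ)
      ≤ (E + 2 * Real.pi / (ε * (2 - γ)) * B) / (n : ℝ) ^ 2 := by
    have hK3 : ((K : ℝ) + 3) ^ 2 ≤ 4 * (n : ℝ) ^ 2 := by rw [hKR]; nlinarith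
    have hSG0 : 0 ≤ sqSum (fun i j => ‖Gc n M σ b u i j‖ ^ 2) K := sqSum_nonneg _ (fun _ _ => sq_nonneg _) _
    calc Et U K + (Real.pi / (2 * ε) * sqSum (fun i j => ‖Gc n M σ b u i j‖ ^ 2) K) * ((K : ℝ) + 3) ^ 2 / (2 - γ)
        ≤ E / (n : ℝ) ^ 2 + (Real.pi / (2 * ε) * (B / (n : ℝ) ^ 4)) * (4 * (n : ℝ) ^ 2) / (2 - γ) := by
          gcongr
      _ = (E + 2 * Real.pi / (ε * (2 - γ)) * B) / (n : ℝ) ^ 2 := by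
          field_simp
          ring
  have step2 : sqSum (fun i j => nbr U i j / (rho i j : ℝ)) K
      ≤ 2 * ((E / (n : ℝ) ^ 2 + 16 / (γ - 1) * ((E + 2 * Real.pi / (ε * (2 - γ)) * B) / (n : ℝ) ^ 2)) / K) := by
    refine hsite.trans ?_
    gcongr
  -- Step 3: arithmetic
  have step3 : (n : ℝ) ^ 3 * (2 * ((E / (n : ℝ) ^ 2 + 16 / (γ - 1) * ((E + 2 * Real.pi / (ε * (2 - γ)) * B) / (n : ℝ) ^ 2)) / K))
      ≤ 4 * (1 + 16 / (γ - 1)) * E + 128 * Real.pi / ((γ - 1) * ε * (2 - γ)) * B := by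
    have hKinv : (n : ℝ) / K ≤ 2 := by rw [div_le_iff₀ hK0, hKR]; linarith
    have e1 : (n : ℝ) ^ 3 * (2 * ((E / (n : ℝ) ^ 2 + 16 / (γ - 1) * ((E + 2 * Real.pi / (ε * (2 - γ)) * B) / (n : ℝ) ^ 2)) / K))
        = ((n : ℝ) / K) * (2 * ((1 + 16 / (γ - 1)) * E + 32 * Real.pi / ((γ - 1) * ε * (2 - γ)) * B)) := by
      field_simp
      ring
    rw [e1]
    have hX : 0 ≤ 2 * ((1 + 16 / (γ - 1)) * E + 32 * Real.pi / ((γ - 1) * ε * (2 - γ)) * B) := by positivity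
    calc (n : ℝ) / K * (2 * ((1 + 16 / (γ - 1)) * E + 32 * Real.pi / ((γ - 1) * ε * (2 - γ)) * B))
        ≤ 2 * (2 * ((1 + 16 / (γ - 1)) * E + 32 * Real.pi / ((γ - 1) * ε * (2 - γ)) * B)) :=
          mul_le_mul_of_nonneg_right hKinv hX
      _ = 4 * (1 + 16 / (γ - 1)) * E + 128 * Real.pi / ((γ - 1) * ε * (2 - γ)) * B := by ring
  calc _ ≤ (n : ℝ) ^ 3 * sqSum (fun i j => nbr U i j / (rho i j : ℝ)) K := step1
    _ ≤ (n : ℝ) ^ 3 * (2 * ((E / (n : ℝ) ^ 2 + 16 / (γ - 1) * ((E + 2 * Real.pi / (ε * (2 - γ)) * B) / (n : ℝ) ^ 2)) / K)) :=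
        mul_le_mul_of_nonneg_left step2 (by positivity)
    _ ≤ _ := step3

end Vertex

/-! ## §3 Binder (B) on the torus -/

section Binder

variable (S : Tor M → Prop) [DecidablePred S] (a' : ℝ)

/-- the constant of binder (B): `β_V = γ′⁻¹(1 + 4|V|(1 + 16/(γ−1))) + |V|·(256π/((γ−1)ε(2−γ)))·(1 + (a′γ′⁻¹)²)`. [folklore] -/
def betaV (cardV : ℕ) (ε a' : ℝ) : ℝ :=
  (gammaPs 2 a')⁻¹ * (1 + 4 * cardV * (1 + 16 / (Real.pi / 3 * (1 - ε / 2) - 1)))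
    + cardV * (256 * Real.pi / ((Real.pi / 3 * (1 - ε / 2) - 1) * ε * (2 - Real.pi / 3 * (1 - ε / 2))))
      * (1 + (a' * (gammaPs 2 a')⁻¹) ^ 2)

/-- **BINDER (B) ON THE TORUS** (d = 2, any set of unit blocks `S`, any finite family `V` of re-entrant vertices of `S`): for
`u = solExt n M a′ Ω f`, `Ω = blockReg n M S`, `2 ≤ n`, `2 ≤ M_ν`, `0 < a′`, `0 < ε`, `1 < γ = π/3·(1−ε/2)`:
`Σ_μ Σ_y ω_V(y)⁻¹·|(∂_μ u)(y)|² ≤ β_V·‖f‖²`. [folklore] -/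
theorem weighted_energy_solExt_le (V : Finset ((Fin 2 → Bool) × Tor M)) (hV : ∀ v ∈ V, ReentrantAt M S v.1 v.2)
    (hn : 2 ≤ n) (hM0 : 2 ≤ M 0) (hM1 : 2 ≤ M 1) (ha' : 0 < a') {ε : ℝ} (hε : 0 < ε) (hγ : 1 < Real.pi / 3 * (1 - ε / 2))
    (f : {y // blockReg n M S y} → ℂ) :
    ∑ μ, ∑ y, (omegaV n M V (n - 1) y)⁻¹ * ‖(sdiff (fine n M) (n : ℂ) μ *ᵥ solExt n M a' (blockReg n M S) f) y‖ ^ 2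
      ≤ betaV V.card ε a' * nsq f := by
  set u := solExt n M a' (blockReg n M S) f with hu
  have hu0 : ∀ x, ¬ blockReg n M S x → u x = 0 := fun x hx => solExt_apply_of_not n M a' _ f hx
  have hγp := (gammaPs_pos (d := 2) (a' := a')).1
  have hπ3 := Real.pi_gt_three
  have hε2 : ε < 2 := by
    by_contra h
    have : Real.pi / 3 * (1 - ε / 2) ≤ 0 := mul_nonpos_of_nonneg_of_nonpos (by positivity) (by linarith)
    linarith
  have hγ1 : 0 < Real.pi / 3 * (1 - ε / 2) - 1 := by linarith
  have h2γ : 0 < 2 - Real.pi / 3 * (1 - ε / 2) := by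
    have h1 : Real.pi / 3 * (1 - ε / 2) ≤ Real.pi / 3 * 1 := mul_le_mul_of_nonneg_left (by linarith) (by positivity)
    linarith [Real.pi_lt_four]
  -- the two global budgets
  have hE : nsq (sdiff (fine n M) (n : ℂ) 0 *ᵥ u) + nsq (sdiff (fine n M) (n : ℂ) 1 *ᵥ u) ≤ (gammaPs 2 a')⁻¹ * nsq f := by
    have h := dirichlet_solExt_le n M a' (blockReg n M S) ha' f
    rw [dirichlet, Fin.sum_univ_two] at h
    exact h
  have hB : ∑ x ∈ univ.filter (blockReg n M S), ‖(LapS (fine n M) (n : ℂ) *ᵥ u) x‖ ^ 2 ≤ 2 * (1 + (a' * (gammaPs 2 a')⁻¹) ^ 2) * nsq f := by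
    rw [Finset.sum_subtype (univ.filter (blockReg n M S)) (p := blockReg n M S) (fun x => by simp)
      (fun x => ‖(LapS (fine n M) (n : ℂ) *ᵥ u) x‖ ^ 2)]
    exact sum_normSq_LapS_solExt_le n M a' (blockReg n M S) ha' f
  have hf0 := nsq_nonneg f
  -- expand ω⁻¹ and split
  have hsplit : ∑ μ, ∑ y, (omegaV n M V (n - 1) y)⁻¹ * ‖(sdiff (fine n M) (n : ℂ) μ *ᵥ u) y‖ ^ 2
      = (nsq (sdiff (fine n M) (n : ℂ) 0 *ᵥ u) + nsq (sdiff (fine n M) (n : ℂ) 1 *ᵥ u))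
        + ∑ v ∈ V, ∑ μ, ∑ y, invW n M v (n - 1) y * ‖(sdiff (fine n M) (n : ℂ) μ *ᵥ u) y‖ ^ 2 := by
    calc ∑ μ, ∑ y, (omegaV n M V (n - 1) y)⁻¹ * ‖(sdiff (fine n M) (n : ℂ) μ *ᵥ u) y‖ ^ 2
        = ∑ μ, ∑ y, (‖(sdiff (fine n M) (n : ℂ) μ *ᵥ u) y‖ ^ 2
            + ∑ v ∈ V, invW n M v (n - 1) y * ‖(sdiff (fine n M) (n : ℂ) μ *ᵥ u) y‖ ^ 2) := by
          refine sum_congr rfl fun μ _ => sum_congr rfl fun y _ => ?_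
          rw [inv_omegaV, add_mul, one_mul, sum_mul]
      _ = (∑ μ, ∑ y, ‖(sdiff (fine n M) (n : ℂ) μ *ᵥ u) y‖ ^ 2)
            + ∑ μ, ∑ y, ∑ v ∈ V, invW n M v (n - 1) y * ‖(sdiff (fine n M) (n : ℂ) μ *ᵥ u) y‖ ^ 2 := by
          simp only [sum_add_distrib]
      _ = _ := by
          congr 1
          · rw [Fin.sum_univ_two, nsq, nsq]
          · calc ∑ μ, ∑ y, ∑ v ∈ V, invW n M v (n - 1) y * ‖(sdiff (fine n M) (n : ℂ) μ *ᵥ u) y‖ ^ 2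
                = ∑ μ, ∑ v ∈ V, ∑ y, invW n M v (n - 1) y * ‖(sdiff (fine n M) (n : ℂ) μ *ᵥ u) y‖ ^ 2 :=
                  sum_congr rfl fun μ _ => sum_comm
              _ = _ := sum_comm
  rw [hsplit]
  have hv : ∀ v ∈ V, ∑ μ, ∑ y, invW n M v (n - 1) y * ‖(sdiff (fine n M) (n : ℂ) μ *ᵥ u) y‖ ^ 2
      ≤ 4 * (1 + 16 / (Real.pi / 3 * (1 - ε / 2) - 1)) * ((gammaPs 2 a')⁻¹ * nsq f)
        + 128 * Real.pi / ((Real.pi / 3 * (1 - ε / 2) - 1) * ε * (2 - Real.pi / 3 * (1 - ε / 2)))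
          * (2 * (1 + (a' * (gammaPs 2 a')⁻¹) ^ 2) * nsq f) := by
    intro v hvV
    have h := vertex_weighted_energy_le n M (σ := v.1) (b := v.2) hu0 (hV v hvV) hn hM0 hM1 hε hγ
    refine h.trans ?_
    gcongr
  calc (nsq (sdiff (fine n M) (n : ℂ) 0 *ᵥ u) + nsq (sdiff (fine n M) (n : ℂ) 1 *ᵥ u))
        + ∑ v ∈ V, ∑ μ, ∑ y, invW n M v (n - 1) y * ‖(sdiff (fine n M) (n : ℂ) μ *ᵥ u) y‖ ^ 2
      ≤ (gammaPs 2 a')⁻¹ * nsq f + ∑ v ∈ V, (4 * (1 + 16 / (Real.pi / 3 * (1 - ε / 2) - 1)) * ((gammaPs 2 a')⁻¹ * nsq f)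
        + 128 * Real.pi / ((Real.pi / 3 * (1 - ε / 2) - 1) * ε * (2 - Real.pi / 3 * (1 - ε / 2)))
          * (2 * (1 + (a' * (gammaPs 2 a')⁻¹) ^ 2) * nsq f)) := add_le_add hE (sum_le_sum hv)
    _ = betaV V.card ε a' * nsq f := by
        rw [sum_const, nsmul_eq_mul, betaV]
        ring

end Binder

end Summit.QuantumFields.BalabanUV.Beta.GAN24.DirichletVertexEnergy

end
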